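import Summits.ValiantsHypothesis.ValiantsHypothesis.Theorems.KPlusLogSqLawOctaveRealChain

/-!
# Route «KPlusLogSqLaw», octave line — file 5b/7: the INTEGERISATION `realChainBound_proof` (real chains obey the integer tropical row) and `designPiecesBound_proof`

HONEST FRAMING.  Octave line of ideator seat val-idea-6 (crux-idea `octave-lifting` on stmt-ValiantsHypothesis-19561, critic-1 PASS 2026-08-27), published as `Cruxes/WeakLifting/Lines/octave.lean`; landed in Theorems shape by prover seat val-width-19561-oc1 (`--supports stmt-ValiantsHypothesis-19561`).  Conjecture B (`KPlusLogSqLaw`), `TropicalB` (stmt-19771), `WeakLifting` (stmt-19561), `MatrixDescartes` (stmt-18050) and the octave statements `OctaveWeakLifting` / `OctaveKLaw` / `OctaveMatrixDescartes` are OPEN and DEFINED, never asserted; nothing in this file proves any of them, and VP ≠ VNP is not moved.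

This file: `realChainBound_proof : RealChainBound` (integer design `v' = −(2^W⌊Q log₂|S|⌋ + 2^idx)`, slopes `2^W⌊Qθ⌋`, binary tie-breaker, margin `Q·μ > mΣd + m + 1`) and `designPiecesBound_proof : DesignPiecesBound` (`TropRowD m K n ⇒ #designBreaks ≤ n` for every REAL pencil design).
-/

set_option linter.dupNamespace false
set_option autoImplicit false

namespace Summit.ValiantsHypothesis.ValiantsHypothesis.Theorems.KPlusLogSqLaw.Octave

open Polynomial Finset
open scoped BigOperators
open Summit.ValiantsHypothesis.ValiantsHypothesis.Theorems.LacunarySymmetroidMatrixDescartes (RealRootLawAt KPlusLogSqLaw)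
open Summit.ValiantsHypothesis.ValiantsHypothesis.Theses.LacunarySymmetroid (MatrixDescartes PencilTransfer ThetaWitness)
open Summit.ValiantsHypothesis.ValiantsHypothesis.Theses.KPlusLogSqLaw (TropicalB WeakLifting)

section Depth

open Finset

variable {m K : ℕ}

section Integerisation

open Summit.ValiantsHypothesis.ValiantsHypothesis.Theorems.MatrixDescartes.Negative (termSign IsDominant tropWeight)
open Summit.ValiantsHypothesis.ValiantsHypothesis.Theorems.KPlusLogSqLaw (TropRowD DesignRowD)

/-- **INTEGERISATION** (PROVED): real chains obey the integer tropical row. -/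
theorem realChainBound_proof : RealChainBound := by
  intro m K n hT d S N θ t hθ hpres hmax htie hslope
  classical
  rcases Nat.eq_zero_or_pos N with h0 | hNpos
  · omega
  -- indexing of the entries
  let idx : Fin m × Fin m × Fin K → ℕ := fun e => (Fintype.equivFin (Fin m × Fin m × Fin K) e : ℕ)
  have hidx : Function.Injective idx := fun a b h => (Fintype.equivFin _).injective (Fin.ext h)
  set W : ℕ := Fintype.card (Fin m × Fin m × Fin K) with hW
  have hidxW : ∀ e, idx e < W := fun e => (Fintype.equivFin _ e).2
  -- margin μ: competitors of another slope class are strictly below the top, uniformly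
  have hstrict : ∀ j τ, rawCoef S τ ≠ 0 → rawSlope d τ ≠ rawSlope d (t j) →
      0 < rawLine d S (t j) (θ j) - rawLine d S τ (θ j) := by
    intro j τ hτ hs
    have h1 := hmax j τ hτ
    rcases h1.lt_or_eq with hlt | heq
    · linarith
    · exact absurd (htie j τ hτ heq) hs
  obtain ⟨μ, hμ, hμle⟩ : ∃ μ : ℝ, 0 < μ ∧ ∀ j τ, rawCoef S τ ≠ 0 → rawSlope d τ ≠ rawSlope d (t j) →
      μ ≤ rawLine d S (t j) (θ j) - rawLine d S τ (θ j) := by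
    let G : Finset ℝ := ((univ : Finset (Fin (N + 1) × RawTerm m K)).filter
        (fun jτ => rawCoef S jτ.2 ≠ 0 ∧ rawSlope d jτ.2 ≠ rawSlope d (t jτ.1))).image
        (fun jτ => rawLine d S (t jτ.1) (θ jτ.1) - rawLine d S jτ.2 (θ jτ.1))
    have hmemG : ∀ j τ, rawCoef S τ ≠ 0 → rawSlope d τ ≠ rawSlope d (t j) →
        rawLine d S (t j) (θ j) - rawLine d S τ (θ j) ∈ G := fun j τ hτ hs =>
      mem_image.2 ⟨(j, τ), mem_filter.2 ⟨mem_univ _, hτ, hs⟩, rfl⟩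
    by_cases hG : G.Nonempty
    · refine ⟨G.min' hG, ?_, fun j τ hτ hs => G.min'_le _ (hmemG j τ hτ hs)⟩
      have hmin := G.min'_mem hG
      obtain ⟨jτ, hjτ, hval⟩ := mem_image.1 hmin
      rw [mem_filter] at hjτ
      rw [← hval]
      exact hstrict jτ.1 jτ.2 hjτ.2.1 hjτ.2.2
    · refine ⟨1, one_pos, fun j τ hτ hs => absurd ⟨_, hmemG j τ hτ hs⟩ hG⟩
  -- gap g of the sample points
  obtain ⟨g, hg, hgle⟩ : ∃ g : ℝ, 0 < g ∧ ∀ i : Fin N, g ≤ θ i.succ - θ i.castSucc := by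
    let G2 : Finset ℝ := (univ : Finset (Fin N)).image (fun i => θ i.succ - θ i.castSucc)
    have hG2 : G2.Nonempty := ⟨_, mem_image_of_mem _ (mem_univ (⟨0, hNpos⟩ : Fin N))⟩
    refine ⟨G2.min' hG2, ?_, fun i => G2.min'_le _ (mem_image_of_mem _ (mem_univ i))⟩
    obtain ⟨i, -, hi⟩ := mem_image.1 (G2.min'_mem hG2)
    rw [← hi]
    exact sub_pos.2 (hθ (show Fin.castSucc i < i.succ from Fin.castSucc_lt_succ))
  -- the scale Q
  set sB : ℕ := m * ∑ l, d l with hsB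
  obtain ⟨Q, hQ⟩ := exists_nat_gt (max (1 / g) (((sB : ℝ) + m + 1) / μ))
  have hQg : 1 < (Q : ℝ) * g := by
    have := (le_max_left _ _).trans_lt hQ
    rw [div_lt_iff₀ hg] at this; linarith
  have hQμ : (sB : ℝ) + m + 1 < Q * μ := by
    have := (le_max_right _ _).trans_lt hQ
    rw [div_lt_iff₀ hμ] at this; linarith
  have hQpos : (0 : ℝ) < Q := by
    have : (0:ℝ) < 1 / g := by positivity
    exact this.trans ((le_max_left _ _).trans_lt hQ)
  -- the integer design and slopes
  let v' : Fin m → Fin m → Fin K → ℤ := fun a b l =>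
    -((2 : ℤ) ^ W * ⌊(Q : ℝ) * Real.logb 2 |S l a b|⌋ + (2 : ℤ) ^ idx (a, b, l))
  let ε' : Fin m → Fin m → Fin K → ℤ := fun a b l => if S l a b = 0 then 0 else 1
  let θ' : Fin (N + 1) → ℤ := fun j => (2 : ℤ) ^ W * ⌊(Q : ℝ) * θ j⌋
  let A : Fin (N + 1) → RawTerm m K → ℤ := fun j τ =>
    ⌊(Q : ℝ) * θ j⌋ * (rawSlope d τ : ℤ) + ∑ i, ⌊(Q : ℝ) * Real.logb 2 |S (τ.2 i) (τ.1 i) i|⌋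
  have hdecomp : ∀ j τ, tropWeight d v' (θ' j) τ = 2 ^ W * A j τ + (tieBreak idx τ : ℤ) := by
    intro j τ
    simp only [tropWeight, v', θ', A, tieBreak, ent, rawSlope, Finset.sum_neg_distrib, sub_neg_eq_add,
      Finset.sum_add_distrib, Nat.cast_sum, Nat.cast_pow, Nat.cast_ofNat, Finset.mul_sum]
    ring_nf
    simp only [Finset.sum_mul]
    ring
  have hpresent : ∀ τ, termSign ε' τ ≠ 0 ↔ rawCoef S τ ≠ 0 := fun τ => termSign_pattern_ne_zero_iff S τ
  -- comparison of weights ⇒ comparison of the integer parts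
  have hAle : ∀ j τ τ', tropWeight d v' (θ' j) τ ≤ tropWeight d v' (θ' j) τ' → A j τ ≤ A j τ' := by
    intro j τ τ' hle
    rw [hdecomp, hdecomp] at hle
    have b1 : (tieBreak idx τ' : ℤ) < 2 ^ W := by exact_mod_cast tieBreak_lt idx hidx W hidxW τ'
    have b2 : (0 : ℤ) ≤ tieBreak idx τ := by positivity
    by_contra hlt
    push Not at hlt
    have h1 : 1 ≤ A j τ - A j τ' := by omega
    have h2 : (2 : ℤ) ^ W * 1 ≤ 2 ^ W * (A j τ - A j τ') := mul_le_mul_of_nonneg_left h1 (by positivity)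
    nlinarith
  have hdistinct : ∀ j τ τ', τ ≠ τ' → tropWeight d v' (θ' j) τ ≠ tropWeight d v' (θ' j) τ' := by
    intro j τ τ' hne heq
    have hA : A j τ = A j τ' := le_antisymm (hAle j τ τ' heq.le) (hAle j τ' τ heq.ge)
    rw [hdecomp, hdecomp, hA] at heq
    have : tieBreak idx τ = tieBreak idx τ' := by exact_mod_cast (add_left_cancel heq)
    exact hne (tieBreak_injective idx hidx this)
  -- dominant terms of the integer design at the integer slopes
  set P' := (univ : Finset (RawTerm m K)).filter (fun τ => termSign ε' τ ≠ 0) with hP'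
  have hP'ne : P'.Nonempty :=
    ⟨t 0, by rw [hP', mem_filter]; exact ⟨mem_univ _, (hpresent _).2 (hpres _)⟩⟩
  have hdomEx : ∀ j, ∃ p ∈ P', ∀ τ ∈ P', tropWeight d v' (θ' j) τ ≤ tropWeight d v' (θ' j) p :=
    fun j => exists_max_image P' _ hP'ne
  choose p hpP' hpmax using hdomEx
  have hp_pres : ∀ j, rawCoef S (p j) ≠ 0 := fun j => by
    have := hpP' j; rw [hP', mem_filter] at this; exact (hpresent _).1 this.2
  have hdom : ∀ j, IsDominant d v' ε' (θ' j) (p j) := by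
    intro j
    refine ⟨(hpresent _).2 (hp_pres j), fun q hq hqs => ?_⟩
    have hle := hpmax j q (by rw [hP', mem_filter]; exact ⟨mem_univ _, hqs⟩)
    exact lt_of_le_of_ne hle (hdistinct j q (p j) hq)
  -- the integer part sandwiches Q · (real line)
  have hAlow : ∀ j τ, rawCoef S τ ≠ 0 → (Q : ℝ) * rawLine d S τ (θ j) - (rawSlope d τ + m) ≤ A j τ := by
    intro j τ hτ
    have hfl1 : (Q : ℝ) * θ j - 1 < ⌊(Q : ℝ) * θ j⌋ := by
      have := Int.lt_floor_add_one ((Q : ℝ) * θ j); linarith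
    have hs0 : (0 : ℝ) ≤ rawSlope d τ := Nat.cast_nonneg _
    have h1 : ((Q : ℝ) * θ j - 1) * rawSlope d τ ≤ (⌊(Q : ℝ) * θ j⌋ : ℝ) * rawSlope d τ :=
      mul_le_mul_of_nonneg_right hfl1.le hs0
    have h2 : ∀ i, (Q : ℝ) * Real.logb 2 |S (τ.2 i) (τ.1 i) i| - 1 < ⌊(Q : ℝ) * Real.logb 2 |S (τ.2 i) (τ.1 i) i|⌋ :=
      fun i => by have := Int.lt_floor_add_one ((Q : ℝ) * Real.logb 2 |S (τ.2 i) (τ.1 i) i|); linarith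
    have h3 : ∑ i, ((Q : ℝ) * Real.logb 2 |S (τ.2 i) (τ.1 i) i| - 1) ≤
        ∑ i, (⌊(Q : ℝ) * Real.logb 2 |S (τ.2 i) (τ.1 i) i|⌋ : ℝ) := Finset.sum_le_sum fun i _ => (h2 i).le
    have h3' : ∑ i : Fin m, ((Q : ℝ) * Real.logb 2 |S (τ.2 i) (τ.1 i) i| - 1) =
        Q * ∑ i, Real.logb 2 |S (τ.2 i) (τ.1 i) i| - m := by
      rw [Finset.sum_sub_distrib, Finset.mul_sum]; simp
    rw [rawLine, rawLog_eq_sum S τ hτ]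
    have hA : (A j τ : ℝ) = (⌊(Q : ℝ) * θ j⌋ : ℝ) * rawSlope d τ + ∑ i, (⌊(Q : ℝ) * Real.logb 2 |S (τ.2 i) (τ.1 i) i|⌋ : ℝ) := by
      simp [A]
    rw [hA]
    linarith [h1, h3, h3']
  have hAup : ∀ j τ, rawCoef S τ ≠ 0 → (A j τ : ℝ) ≤ (Q : ℝ) * rawLine d S τ (θ j) := by
    intro j τ hτ
    have hs0 : (0 : ℝ) ≤ rawSlope d τ := Nat.cast_nonneg _
    have h1 : (⌊(Q : ℝ) * θ j⌋ : ℝ) * rawSlope d τ ≤ ((Q : ℝ) * θ j) * rawSlope d τ :=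
      mul_le_mul_of_nonneg_right (Int.floor_le _) hs0
    have h3 : ∑ i, (⌊(Q : ℝ) * Real.logb 2 |S (τ.2 i) (τ.1 i) i|⌋ : ℝ) ≤ (Q : ℝ) * ∑ i, Real.logb 2 |S (τ.2 i) (τ.1 i) i| := by
      rw [Finset.mul_sum]; exact Finset.sum_le_sum fun i _ => Int.floor_le _
    rw [rawLine, rawLog_eq_sum S τ hτ]
    have hA : (A j τ : ℝ) = (⌊(Q : ℝ) * θ j⌋ : ℝ) * rawSlope d τ + ∑ i, (⌊(Q : ℝ) * Real.logb 2 |S (τ.2 i) (τ.1 i) i|⌋ : ℝ) := by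
      simp [A]
    rw [hA]
    linarith [h1, h3]
  -- near-topness of p j against t j, hence same slope class
  have hsp : ∀ j, rawSlope d (p j) = rawSlope d (t j) := by
    intro j
    by_contra hs
    have hμ1 := hμle j (p j) (hp_pres j) hs
    have hw : tropWeight d v' (θ' j) (t j) ≤ tropWeight d v' (θ' j) (p j) :=
      hpmax j (t j) (by rw [hP', mem_filter]; exact ⟨mem_univ _, (hpresent _).2 (hpres _)⟩)
    have hA1 : (A j (t j) : ℝ) ≤ A j (p j) := by exact_mod_cast hAle j _ _ hw
    have hlo := hAlow j (t j) (hpres j)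
    have hup := hAup j (p j) (hp_pres j)
    have hsl : (rawSlope d (t j) : ℝ) ≤ sB := by exact_mod_cast rawSlope_le d (t j)
    -- Q · gap < sB + m + 1 < Q μ ≤ Q · gap : contradiction
    have hgap : (Q : ℝ) * (rawLine d S (t j) (θ j) - rawLine d S (p j) (θ j)) < sB + m + 1 := by linarith
    have : (Q : ℝ) * μ ≤ Q * (rawLine d S (t j) (θ j) - rawLine d S (p j) (θ j)) :=
      mul_le_mul_of_nonneg_left hμ1 hQpos.le
    linarith
  -- the integer chain is admissible
  have hθ' : StrictMono θ' := by
    refine Fin.strictMono_iff_lt_succ.2 fun i => ?_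
    have hgi := hgle i
    have h1 : (Q : ℝ) * θ i.castSucc + 1 ≤ (Q : ℝ) * θ i.succ := by nlinarith
    have h2 : ⌊(Q : ℝ) * θ i.castSucc⌋ + 1 ≤ ⌊(Q : ℝ) * θ i.succ⌋ := by
      rw [← Int.floor_add_one]; exact Int.floor_le_floor h1
    show (2 : ℤ) ^ W * ⌊(Q : ℝ) * θ i.castSucc⌋ < 2 ^ W * ⌊(Q : ℝ) * θ i.succ⌋
    exact mul_lt_mul_of_pos_left (by omega) (by positivity)
  have hne : ∀ i : Fin N, p i.castSucc ≠ p i.succ := by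
    intro i heq
    have h1 := hslope (show Fin.castSucc i < i.succ from Fin.castSucc_lt_succ)
    simp only at h1
    rw [← hsp, ← hsp, heq] at h1
    exact lt_irrefl _ h1
  exact hT d v' ε' N θ' p hθ' hdom hne

end Integerisation

/-- piece 1, PROVED: `TropRowD m K n ⇒ #designBreaks ≤ n` for every real pencil design. -/
theorem designPiecesBound_proof : DesignPiecesBound :=
  designPiecesBound_of_realChainBound realChainBound_proof

end Depth

end Summit.ValiantsHypothesis.ValiantsHypothesis.Theorems.KPlusLogSqLaw.Octave
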